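import Summits.QuantumAdvantage.QuantumAdvantage.Theorems.SosSandwichTransferPBAdvisedTree
import Literature.Computability.QuantumComplexity.AaronsonAmbainisThm23Queries
import HarnessLib

/-!
# Crux `TransferPB` (stmt-QuantumAdvantage-15238, route SosSandwich), line `birth` — advised trees with an ABSTRACT POTENTIAL

Toward the machine half of stub `stub_pbOracleSimulation`. The analysis of Aaronson–Ambainis' Thm. 21 for
advised trees (`Theorems/SosSandwichTransferPBAdvisedTree.lean`, `advTree_error_le`) bounds the expected number
of queries by the INFLUENCE potential `Σ_j Inf_j[p|_ρ]`: a picked variable must have influence `≥ w`. A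
polynomial-time machine with a promise-`BQP` oracle, however, cannot locate influential bits among the
exponentially many relevant oracle bits; what it CAN locate (by heavy-prefix descent on gapped block tests) are
bits of large QUERY MAGNITUDE (Bennett–Bernstein–Brassard–Vazirani), and the natural machine queries those.
Its expected number of queries is then controlled by a different potential — the total query magnitude of the
free bits, `Σ_{s free} m̄_s(ρ) ≤ T`, which also halves-on-average when a bit is fixed. This file therefore
redoes the analysis for an ABSTRACT potential `Φ` on paths:

* POTENTIAL-SOUNDNESS (five inline hypotheses, no new definition): picks are FRESH (never a bit already on the
  path), `Φ ≥ 0`, a pick at `ρ` DROPS the potential: `Φ(ρ·(i,0)) + Φ(ρ·(i,1)) + 2τ ≤ 2Φ(ρ)`, a refusal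
  certifies `Var[p|_ρ] ≤ θ`, leaf values are `η`-accurate;
* `advTree_flipBit_of_mem` — with fresh picks, the subtree below a path containing bit `i` ignores `x_i`;
* `sum_cost_advTree_mul_le_pot` — `τ · Σ_x #queries(x) ≤ 2^N · Φ(ρ)`;
* `haltError_advTree_le_pot` — Chebyshev at the refusal leaves: `#{halts early, errs by > ε+η}·ε² ≤ 2^N θ`;
* **`advTree_error_le_pot`** — with `θ = ε²δ/2` and budget `D ≥ 2Φ([])/(τδ)`:
  `#{x : |t(x) − p(x)| > ε + η} ≤ δ·2^N` (no degree or boundedness hypothesis is needed);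
* **`measure_advTree_acceptPoly_deviation_le_pot`** — the same over the random oracle for `p = p_x`, the
  acceptance polynomial of an oracle circuit family (`randomOracleMeasure_oracleBits_mem`).

The influence-sound advisors of `…AdvisedTree.lean` are the instance `Φ(ρ) = Σ_j Inf_j[p|_ρ]`, `τ = w`
(`sum_influence_restrictPoly_add`); the magnitude potential is the intended machine instance. All proved; no
named fact. Source: S. Aaronson, A. Ambainis, Theory Comput. 10 (2014), Thm. 21 (proof, arXiv:0911.0996v3
pp. 13–14); C. H. Bennett, E. Bernstein, G. Brassard, U. Vazirani, SIAM J. Comput. 26 (1997), Thm. 3.3.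
-/

-- D-0017: single-conjunct summit ⇒ the duplicate `QuantumAdvantage.QuantumAdvantage` is mandated.
set_option linter.dupNamespace false

noncomputable section

namespace Summit.QuantumAdvantage.QuantumAdvantage.Cruxes.TransferPB.Birth

open Finset MeasureTheory Literature.Computability.Cryptography
  Literature.Computability.QuantumComplexity Literature.Computability.QuantumComplexity.ClassicalSimulation
open scoped ENNReal

namespace SimTreePB

variable {N : ℕ}

variable {A : Advisor N} {p : MvPolynomial (Fin N) ℝ} {Φ : List (Fin N × Bool) → ℝ} {θ τ η : ℝ}

/-- **Fresh picks never re-query a bit**: below a path containing bit `i`, the output and the path length of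
the advised tree are invariant under flipping `x_i`. [cite: AaronsonAmbainis2014, Thm. 21 (proof)] -/
theorem advTree_flipBit_of_mem
    (hfresh : ∀ (ρ : List (Fin N × Bool)) (i : Fin N), A.pick ρ = some i → i ∉ ρ.map Prod.fst) (i : Fin N) :
    ∀ (D : ℕ) (ρ : List (Fin N × Bool)), i ∈ ρ.map Prod.fst →
      ∀ x, (advTree A D ρ).eval (flipBit i x) = (advTree A D ρ).eval x ∧
        (advTree A D ρ).cost (flipBit i x) = (advTree A D ρ).cost x
  | 0, ρ, _, x => by simp
  | D + 1, ρ, hmem, x => by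
    cases hp : A.pick ρ with
    | none => rw [advTree_succ_of_none A hp]; simp
    | some j =>
      rw [advTree_succ_of_some A hp]
      have hji : j ≠ i := by
        intro hji
        subst hji
        exact hfresh ρ j hp hmem
      have hmem' : ∀ b : Bool, i ∈ (ρ ++ [(j, b)]).map Prod.fst := fun b => by
        simp only [List.map_append, List.mem_append]
        exact Or.inl hmem
      have IH0 := advTree_flipBit_of_mem hfresh i D (ρ ++ [(j, false)]) (hmem' false) x
      have IH1 := advTree_flipBit_of_mem hfresh i D (ρ ++ [(j, true)]) (hmem' true) x
      simp only [RealDecisionTree.eval_query, RealDecisionTree.cost_query, flipBit_apply_of_ne hji]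
      cases x j <;> simp [IH0.1, IH0.2, IH1.1, IH1.2]

/-- **Expected number of queries from the potential**: `τ · Σ_x #queries(x) ≤ 2^N · Φ(ρ)`.
[cite: AaronsonAmbainis2014, Thm. 21 (proof, pp. 13–14)] -/
theorem sum_cost_advTree_mul_le_pot
    (hfresh : ∀ (ρ : List (Fin N × Bool)) (i : Fin N), A.pick ρ = some i → i ∉ ρ.map Prod.fst)
    (hΦ0 : ∀ ρ : List (Fin N × Bool), 0 ≤ Φ ρ)
    (hdrop : ∀ (ρ : List (Fin N × Bool)) (i : Fin N), A.pick ρ = some i →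
      Φ (ρ ++ [(i, false)]) + Φ (ρ ++ [(i, true)]) + 2 * τ ≤ 2 * Φ ρ) :
    ∀ (D : ℕ) (ρ : List (Fin N × Bool)), (∑ x, ((advTree A D ρ).cost x : ℝ)) * τ ≤ 2 ^ N * Φ ρ
  | 0, ρ => by
    simp only [advTree_zero, RealDecisionTree.cost_leaf, Nat.cast_zero, Finset.sum_const_zero, zero_mul]
    exact mul_nonneg (by positivity) (hΦ0 ρ)
  | D + 1, ρ => by
    cases hp : A.pick ρ with
    | none =>
      rw [advTree_succ_of_none A hp]
      simp only [RealDecisionTree.cost_leaf, Nat.cast_zero, Finset.sum_const_zero, zero_mul]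
      exact mul_nonneg (by positivity) (hΦ0 ρ)
    | some i =>
      rw [advTree_succ_of_some A hp]
      set T0 := advTree A D (ρ ++ [(i, false)]) with hT0
      set T1 := advTree A D (ρ ++ [(i, true)]) with hT1
      have IH0 := sum_cost_advTree_mul_le_pot hfresh hΦ0 hdrop D (ρ ++ [(i, false)])
      have IH1 := sum_cost_advTree_mul_le_pot hfresh hΦ0 hdrop D (ρ ++ [(i, true)])
      rw [← hT0] at IH0
      rw [← hT1] at IH1
      have hmem : ∀ b : Bool, i ∈ (ρ ++ [(i, b)]).map Prod.fst := fun b => by simp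
      have hinv0 : ∀ x, (T0.cost (flipBit i x) : ℝ) = T0.cost x := fun x => by
        rw [(advTree_flipBit_of_mem hfresh i D (ρ ++ [(i, false)]) (hmem false) x).2]
      have hinv1 : ∀ x, (T1.cost (flipBit i x) : ℝ) = T1.cost x := fun x => by
        rw [(advTree_flipBit_of_mem hfresh i D (ρ ++ [(i, true)]) (hmem true) x).2]
      have hsplit : ∑ x : Fin N → Bool, (((if x i then T1.cost x else T0.cost x) + 1 : ℕ) : ℝ) =
          (∑ x, (T0.cost x : ℝ)) / 2 + (∑ x, (T1.cost x : ℝ)) / 2 + 2 ^ N := by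
        rw [← sum_ite_apply_eq_half i false hinv0, ← sum_ite_apply_eq_half i true hinv1,
          ← Finset.sum_add_distrib, ← mul_one ((2 : ℝ) ^ N), ← sum_const_cube,
          ← Finset.sum_add_distrib]
        refine Finset.sum_congr rfl fun x _ => ?_
        cases x i <;> simp
      have hdrop' := hdrop ρ i hp
      have h2N : (0 : ℝ) ≤ 2 ^ N := by positivity
      simp only [RealDecisionTree.cost_query]
      rw [hsplit]
      nlinarith [IH0, IH1, hdrop', h2N]

/-- **Correctness when halting** (Chebyshev at the refusal leaves, leaf-value slack `η`): the inputs whose path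
halts within the budget and whose output errs from `p|_ρ` by more than `ε + η` number at most `2^N θ/ε²`.
[cite: AaronsonAmbainis2014, Thm. 21 (proof, pp. 13–14)] -/
theorem haltError_advTree_le_pot
    (hfresh : ∀ (ρ : List (Fin N × Bool)) (i : Fin N), A.pick ρ = some i → i ∉ ρ.map Prod.fst)
    (hnone : ∀ ρ : List (Fin N × Bool), A.pick ρ = none → boolVariance (restrictPath ρ p) ≤ θ)
    (hval : ∀ ρ : List (Fin N × Bool), |A.val ρ - boolAvg (evalBool (restrictPath ρ p))| ≤ η)
    (hθ : 0 ≤ θ) {ε : ℝ} (hε : 0 < ε) :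
    ∀ (D : ℕ) (ρ : List (Fin N × Bool)),
      (∑ x, if (advTree A D ρ).cost x < D ∧ ε + η < |(advTree A D ρ).eval x - evalBool (restrictPath ρ p) x|
        then (1 : ℝ) else 0) * ε ^ 2 ≤ 2 ^ N * θ
  | 0, ρ => by
    simp only [Nat.not_lt_zero, false_and, if_false, Finset.sum_const_zero, zero_mul]
    positivity
  | D + 1, ρ => by
    cases hp : A.pick ρ with
    | none =>
      rw [advTree_succ_of_none A hp]
      set q := restrictPath ρ p with hq
      have hvar : boolVariance q ≤ θ := hnone ρ hp
      have hval' : |A.val ρ - boolAvg (evalBool q)| ≤ η := hval ρ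
      simp only [RealDecisionTree.cost_leaf, Nat.zero_lt_succ, true_and, RealDecisionTree.eval_leaf]
      calc (∑ x, if ε + η < |A.val ρ - evalBool q x| then (1 : ℝ) else 0) * ε ^ 2
          = ∑ x, (if ε + η < |A.val ρ - evalBool q x| then ε ^ 2 else 0) := by
            rw [Finset.sum_mul]
            refine Finset.sum_congr rfl fun x _ => ?_
            split_ifs <;> simp
        _ ≤ ∑ x, (evalBool q x - boolAvg (evalBool q)) ^ 2 := by
            refine Finset.sum_le_sum fun x _ => ?_
            split_ifs with hx
            · have htri : |A.val ρ - evalBool q x| ≤ |A.val ρ - boolAvg (evalBool q)| + |boolAvg (evalBool q) - evalBool q x| :=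
                abs_sub_le (A.val ρ) (boolAvg (evalBool q)) (evalBool q x)
              have hx' : ε < |boolAvg (evalBool q) - evalBool q x| := by linarith [hval']
              have h1 : ε ^ 2 ≤ |boolAvg (evalBool q) - evalBool q x| ^ 2 :=
                pow_le_pow_left₀ hε.le hx'.le 2
              rw [sq_abs] at h1
              nlinarith [h1]
            · positivity
        _ = 2 ^ N * boolVariance q := by
            have h2 : (2 : ℝ) ^ N ≠ 0 := by positivity
            have hmul : ∀ s : ℝ, 2 ^ N * (s / 2 ^ N) = s := fun s => mul_div_cancel₀ s h2
            show _ = 2 ^ N * ((∑ x, (evalBool q x - boolAvg (evalBool q)) ^ 2) / 2 ^ N)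
            rw [hmul]
        _ ≤ 2 ^ N * θ := by gcongr
    | some i =>
      rw [advTree_succ_of_some A hp]
      set q := restrictPath ρ p with hq
      set T0 := advTree A D (ρ ++ [(i, false)]) with hT0
      set T1 := advTree A D (ρ ++ [(i, true)]) with hT1
      have IH0 := haltError_advTree_le_pot hfresh hnone hval hθ hε D (ρ ++ [(i, false)])
      have IH1 := haltError_advTree_le_pot hfresh hnone hval hθ hε D (ρ ++ [(i, true)])
      rw [← hT0, restrictPath_append, ← hq] at IH0
      rw [← hT1, restrictPath_append, ← hq] at IH1
      have hmem : ∀ b : Bool, i ∈ (ρ ++ [(i, b)]).map Prod.fst := fun b => by simp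
      set G0 : (Fin N → Bool) → ℝ := fun x =>
        if T0.cost x < D ∧ ε + η < |T0.eval x - evalBool (restrictPoly i false q) x| then (1 : ℝ) else 0 with hG0
      set G1 : (Fin N → Bool) → ℝ := fun x =>
        if T1.cost x < D ∧ ε + η < |T1.eval x - evalBool (restrictPoly i true q) x| then (1 : ℝ) else 0 with hG1
      have hinv0 : ∀ x, G0 (flipBit i x) = G0 x := fun x => by
        have hf := advTree_flipBit_of_mem hfresh i D (ρ ++ [(i, false)]) (hmem false) x
        simp only [hG0]
        rw [hf.1, hf.2, evalBool_restrictPoly_flipBit]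
      have hinv1 : ∀ x, G1 (flipBit i x) = G1 x := fun x => by
        have hf := advTree_flipBit_of_mem hfresh i D (ρ ++ [(i, true)]) (hmem true) x
        simp only [hG1]
        rw [hf.1, hf.2, evalBool_restrictPoly_flipBit]
      have hpt : ∀ x : Fin N → Bool,
          (if (RealDecisionTree.query i T0 T1).cost x < D + 1 ∧
              ε + η < |(RealDecisionTree.query i T0 T1).eval x - evalBool q x| then (1 : ℝ) else 0) =
            (if x i = false then G0 x else 0) + (if x i = true then G1 x else 0) := by
        intro x
        simp only [RealDecisionTree.cost_query, RealDecisionTree.eval_query, hG0, hG1]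
        by_cases hxi : x i = true
        · have hx : Function.update x i true = x := by rw [← hxi, Function.update_eq_self]
          simp [evalBool_restrictPoly, hx, hxi]
        · have hxi' : x i = false := by simpa using hxi
          have hx : Function.update x i false = x := by rw [← hxi', Function.update_eq_self]
          simp [evalBool_restrictPoly, hx, hxi']
      rw [Finset.sum_congr rfl (fun x _ => hpt x), Finset.sum_add_distrib,
        sum_ite_apply_eq_half i false hinv0, sum_ite_apply_eq_half i true hinv1]
      nlinarith [IH0, IH1]

/-- **Error bound for potential-sound advised trees.** For an advisor potential-sound for `p` with parameters
`θ = ε²δ/2`, `τ > 0`, `η` and potential `Φ`, and a budget `D ≥ 2Φ([])/(τδ)`: the advised tree from the empty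
path errs from `p` by more than `ε + η` on at most `δ · 2^N` inputs (Chebyshev at the leaves + Markov on the
budget-exhaustion event via the potential; `D ≥ 1` excludes the degenerate empty budget). No degree or
boundedness hypothesis on `p`.
[cite: AaronsonAmbainis2014, Thm. 21 (proof, pp. 13–14)] -/
theorem advTree_error_le_pot {ε δ : ℝ} (hε : 0 < ε) (hδ : 0 < δ) (hτ : 0 < τ)
    (hfresh : ∀ (ρ : List (Fin N × Bool)) (i : Fin N), A.pick ρ = some i → i ∉ ρ.map Prod.fst)
    (hΦ0 : ∀ ρ : List (Fin N × Bool), 0 ≤ Φ ρ)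
    (hdrop : ∀ (ρ : List (Fin N × Bool)) (i : Fin N), A.pick ρ = some i →
      Φ (ρ ++ [(i, false)]) + Φ (ρ ++ [(i, true)]) + 2 * τ ≤ 2 * Φ ρ)
    (hnone : ∀ ρ : List (Fin N × Bool), A.pick ρ = none → boolVariance (restrictPath ρ p) ≤ ε ^ 2 * δ / 2)
    (hval : ∀ ρ : List (Fin N × Bool), |A.val ρ - boolAvg (evalBool (restrictPath ρ p))| ≤ η)
    {D : ℕ} (hD0 : 0 < D) (hD : 2 * Φ [] / (τ * δ) ≤ D) :
    ((univ.filter fun x : Fin N → Bool => ε + η < |(advTree A D []).eval x - evalBool p x|).card : ℝ) ≤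
      δ * 2 ^ N := by
  set θ : ℝ := ε ^ 2 * δ / 2 with hθ
  have hθpos : 0 < θ := by positivity
  set t := advTree A D [] with ht
  have hA := sum_cost_advTree_mul_le_pot hfresh hΦ0 hdrop D []
  have hB := haltError_advTree_le_pot hfresh hnone hval hθpos.le hε D []
  rw [← ht, restrictPath_nil] at hB
  rw [← ht] at hA
  have hM := t.markov_cost D
  have hpt : ∀ x, (if ε + η < |t.eval x - evalBool p x| then (1 : ℝ) else 0) ≤
      (if t.cost x < D ∧ ε + η < |t.eval x - evalBool p x| then (1 : ℝ) else 0) +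
        (if t.cost x = D then (1 : ℝ) else 0) := by
    intro x
    have hc : t.cost x ≤ D := cost_advTree_le A D [] x
    rcases hc.lt_or_eq with hlt | heq
    · by_cases hb : ε + η < |t.eval x - evalBool p x| <;> simp [hlt, hlt.ne, hb]
    · by_cases hb : ε + η < |t.eval x - evalBool p x| <;> simp [heq, hb]
  have hcard : ((Finset.univ.filter fun x : Fin N → Bool =>
      ε + η < |t.eval x - evalBool p x|).card : ℝ) =
        ∑ x, (if ε + η < |t.eval x - evalBool p x| then (1 : ℝ) else 0) := by
    rw [Finset.natCast_card_filter]
  rw [hcard]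
  set S1 : ℝ := ∑ x, (if t.cost x < D ∧ ε + η < |t.eval x - evalBool p x| then (1 : ℝ) else 0) with hS1
  set S2 : ℝ := ∑ x, (if t.cost x = D then (1 : ℝ) else 0) with hS2
  have hsum : ∑ x, (if ε + η < |t.eval x - evalBool p x| then (1 : ℝ) else 0) ≤ S1 + S2 := by
    rw [hS1, hS2, ← Finset.sum_add_distrib]
    exact Finset.sum_le_sum fun x _ => hpt x
  have h1 : S1 ≤ 2 ^ N * (δ / 2) := by
    have hε2 : 0 < ε ^ 2 := by positivity
    have : S1 * ε ^ 2 ≤ 2 ^ N * (δ / 2) * ε ^ 2 := by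
      calc S1 * ε ^ 2 ≤ 2 ^ N * θ := hB
        _ = 2 ^ N * (δ / 2) * ε ^ 2 := by rw [hθ]; ring
    exact le_of_mul_le_mul_right this hε2
  have h2 : S2 ≤ 2 ^ N * (δ / 2) := by
    have h2N : (0 : ℝ) ≤ 2 ^ N := by positivity
    have hDpos : (0 : ℝ) < D := by exact_mod_cast hD0
    have hDτpos : (0 : ℝ) < D * τ := by positivity
    -- `D · S2 · τ ≤ 2^N Φ([])` (Markov + potential) and `2 Φ([]) ≤ D τ δ` (budget)
    have hS2D : (D : ℝ) * S2 * τ ≤ 2 ^ N * Φ [] := by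
      calc (D : ℝ) * S2 * τ ≤ (∑ x, (t.cost x : ℝ)) * τ := mul_le_mul_of_nonneg_right hM hτ.le
        _ ≤ 2 ^ N * Φ [] := hA
    have hDτ : 2 * Φ [] ≤ (D : ℝ) * (τ * δ) := (div_le_iff₀ (by positivity)).mp hD
    have h4 : (2 : ℝ) ^ N * (2 * Φ []) ≤ 2 ^ N * ((D : ℝ) * (τ * δ)) := mul_le_mul_of_nonneg_left hDτ h2N
    have h5 : S2 * (D * τ) * 2 ≤ 2 ^ N * (δ / 2) * (D * τ) * 2 := by nlinarith [hS2D, h4]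
    have h6 : S2 * ((D : ℝ) * τ) ≤ 2 ^ N * (δ / 2) * ((D : ℝ) * τ) := by linarith
    exact le_of_mul_le_mul_right h6 hDτpos
  linarith

/-! ### Over the random oracle: the acceptance polynomial -/

section Measure

variable {G : QGateSet} (F : QCircuitFamily G) (x : List Bool)

/-- **Deviation bound for potential-sound advised trees on `p_x`, over the random oracle.** For ANY advisor
potential-sound for the acceptance polynomial `p_x = acceptPoly F x` (fresh picks, potential `Φ ≥ 0` dropping
by `τ` at picks, refusals certifying `Var ≤ ε²δ/2`, `η`-accurate values) and a budget
`D ≥ max(1, 2Φ([])/(τδ))`: `μ {A | |t(A) − Pr[F^A accepts x]| > ε + η} ≤ δ`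
(`advTree_error_le_pot` + uniformity of the relevant oracle bits). [cite: AaronsonAmbainis2014, Thm. 21 and proof of Thm. 23 (p. 14)] -/
theorem measure_advTree_acceptPoly_deviation_le_pot {Adv : Advisor (numOracleBits F x)}
    {Φ : List (Fin (numOracleBits F x) × Bool) → ℝ} {ε δ τ η : ℝ} (hε : 0 < ε) (hδ : 0 < δ) (hτ : 0 < τ)
    (hfresh : ∀ (ρ : List (Fin (numOracleBits F x) × Bool)) (i : Fin (numOracleBits F x)),
      Adv.pick ρ = some i → i ∉ ρ.map Prod.fst)
    (hΦ0 : ∀ ρ : List (Fin (numOracleBits F x) × Bool), 0 ≤ Φ ρ)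
    (hdrop : ∀ (ρ : List (Fin (numOracleBits F x) × Bool)) (i : Fin (numOracleBits F x)), Adv.pick ρ = some i →
      Φ (ρ ++ [(i, false)]) + Φ (ρ ++ [(i, true)]) + 2 * τ ≤ 2 * Φ ρ)
    (hnone : ∀ ρ : List (Fin (numOracleBits F x) × Bool), Adv.pick ρ = none →
      boolVariance (restrictPath ρ (acceptPoly F x)) ≤ ε ^ 2 * δ / 2)
    (hval : ∀ ρ : List (Fin (numOracleBits F x) × Bool),
      |Adv.val ρ - boolAvg (evalBool (restrictPath ρ (acceptPoly F x)))| ≤ η)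
    {D : ℕ} (hD0 : 0 < D) (hD : 2 * Φ [] / (τ * δ) ≤ D) :
    randomOracleMeasure {A : Set (List Bool) |
        ε + η < |(advTree Adv D []).eval (oracleBits F x A) - F.acceptProbOn A x|} ≤ ENNReal.ofReal δ := by
  classical
  set t := advTree Adv D [] with ht
  have herr := advTree_error_le_pot (A := Adv) hε hδ hτ hfresh hΦ0 hdrop hnone hval hD0 hD
  rw [← ht] at herr
  have hset : {A : Set (List Bool) | ε + η < |t.eval (oracleBits F x A) - F.acceptProbOn A x|} =
      {A : Set (List Bool) |
        oracleBits F x A ∈ univ.filter fun b => ε + η < |t.eval b - evalBool (acceptPoly F x) b|} := by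
    ext A
    simp only [Set.mem_setOf_eq, mem_filter, mem_univ, true_and, evalBool_acceptPoly]
  rw [hset, randomOracleMeasure_oracleBits_mem]
  set S := univ.filter fun b : Fin (numOracleBits F x) → Bool =>
    ε + η < |t.eval b - evalBool (acceptPoly F x) b| with hS'
  have hcard : (S.card : ℝ) ≤ δ * 2 ^ numOracleBits F x := herr
  have hmeas : (S.card : ℝ≥0∞) * 2⁻¹ ^ numOracleBits F x =
      ENNReal.ofReal ((S.card : ℝ) / 2 ^ numOracleBits F x) := by
    rw [ENNReal.ofReal_div_of_pos (by positivity), ENNReal.ofReal_natCast, ENNReal.ofReal_pow (by norm_num),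
      ENNReal.ofReal_ofNat, ← ENNReal.inv_pow, div_eq_mul_inv]
  rw [hmeas]
  refine ENNReal.ofReal_le_ofReal ?_
  rw [div_le_iff₀ (by positivity)]
  exact hcard

end Measure

end SimTreePB

end Summit.QuantumAdvantage.QuantumAdvantage.Cruxes.TransferPB.Birth

end
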